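import Literature.NumberTheory.Rogawski1990.ArchBouazizStableFamily          -- ★ p849717: `stOrbFamH`, `archBzPeriodic_stOrbFamH`, `archBzWeyl_stOrbFamH (hneg)`
import Literature.NumberTheory.Rogawski1990.ArchBouazizStableFamilySupport   -- ★ p849788: `archBzCompactSupport_stOrbFamH`
import Literature.NumberTheory.Automorphic.ArchEndoscopicChartOrbWeyl        -- ★ p849838 (LH2-p04 (g3)): `chartOrbH_negXAt`
import HarnessLib

/-!
# The stable orbital family on `H_∞ = U(2) × U(1)`: the Weyl clause (W) unconditionally, and the observable conjuncts packaged

Line LH3 of crux H413 (stub `stub_N9`, direct road, organ O-L3′ of `F0/P3c/LH3/LH3-plan/g2/PACK-SPEC.v1.md`).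

★ `archBzWeyl_stOrbFamH` (p849717) proved clause (W) of the Bouaziz space `ArchBouazizSpaceH` for the normalised stable
orbital family `stOrbFamH L νH fH` modulo ONE hypothesis `hneg` — invariance of the chart orbital functional `chartOrbH` under the
realised reflection `x_w ↦ -x_w` of a split place.  ★ `chartOrbH_negXAt` (LH2-p04 (g3), p849838) proves exactly that, for every
coordinate and every Haar measure `νH`; this file discharges `hneg` and packages the three OBSERVABLE conjuncts
(P) periodicity, (W) Weyl symmetry, (I₄) compact support modulo the centre-free split part — all unconditional for a compactly
supported test function `fH` — together with the assembly of the full `ArchBouazizSpaceH` membership from the two remaining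
analytic conjuncts (I₃) (smooth + locally bounded derivatives on the chambers) and (J) (Harish-Chandra jump relations), which are
organs O-L1/O-J of the line and are taken here as named hypotheses.

References: Shelstad 1979, §4 pp. 22–23 (the symmetries of stable orbital integrals on a Cartan); Bouaziz 1994, §6.2 p. 591
(the space `𝓘(𝔥)` cut out by (P), (W), (I₃), (J), (I₄)); Rogawski 1990, §3.6 p. 31 and §8.2 p. 122 (the archimedean charts).
-/

set_option autoImplicit false

noncomputable section

open MeasureTheory NumberField NumberField.InfinitePlace Complex Set Function Real
open Literature.NumberTheory.Automorphic Literature.NumberTheory.Automorphic.UnitaryGroup Literature.NumberTheory.Automorphic.ArchCartan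
open scoped Classical

namespace Literature.NumberTheory.Rogawski1990

variable (L : Type) [Field L] [NumberField L] [IsCMField L]
  [MeasurableSpace (↥(arch (↥(maximalRealSubfield L)) L (IsCMField.complexConj L) 2 (Matrix.of fun i j : Fin 2 => if i.val + j.val + 1 = 2 then (1 : L) else 0)) ×
      ↥(arch (↥(maximalRealSubfield L)) L (IsCMField.complexConj L) 1 (Matrix.of fun i j : Fin 1 => if i.val + j.val + 1 = 1 then (1 : L) else 0)))]
  [BorelSpace (↥(arch (↥(maximalRealSubfield L)) L (IsCMField.complexConj L) 2 (Matrix.of fun i j : Fin 2 => if i.val + j.val + 1 = 2 then (1 : L) else 0)) ×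
      ↥(arch (↥(maximalRealSubfield L)) L (IsCMField.complexConj L) 1 (Matrix.of fun i j : Fin 1 => if i.val + j.val + 1 = 1 then (1 : L) else 0)))]
  (νH : Measure (↥(arch (↥(maximalRealSubfield L)) L (IsCMField.complexConj L) 2 (Matrix.of fun i j : Fin 2 => if i.val + j.val + 1 = 2 then (1 : L) else 0)) ×
      ↥(arch (↥(maximalRealSubfield L)) L (IsCMField.complexConj L) 1 (Matrix.of fun i j : Fin 1 => if i.val + j.val + 1 = 1 then (1 : L) else 0))))
  [νH.IsHaarMeasure] [νH.IsMulRightInvariant]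

/-- **(W) FOR THE STABLE ORBITAL FAMILY, UNCONDITIONALLY** (Haar frame): `ArchBzWeyl (stOrbFamH L νH fH)` for every test function
`fH` — ★ `archBzWeyl_stOrbFamH` with its reflection hypothesis discharged by ★ `chartOrbH_negXAt`.
[cite: Shelstad1979, §4 p. 23] [cite: Bouaziz1994IntegralesOrbitales, §6.2 p. 591] -/
theorem archBzWeyl_stOrbFamH_of_isHaarMeasure (fH : ↥(arch (↥(maximalRealSubfield L)) L (IsCMField.complexConj L) 2 (Matrix.of fun i j : Fin 2 => if i.val + j.val + 1 = 2 then (1 : L) else 0)) ×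
      ↥(arch (↥(maximalRealSubfield L)) L (IsCMField.complexConj L) 1 (Matrix.of fun i j : Fin 1 => if i.val + j.val + 1 = 1 then (1 : L) else 0)) → ℂ) :
    ArchBzWeyl (stOrbFamH L νH fH) :=
  archBzWeyl_stOrbFamH L νH fH fun S _ hw c _ => chartOrbH_negXAt L νH S hw fH c

/-- **THE OBSERVABLE CONJUNCTS (P), (W), (I₄) OF `ArchBouazizSpaceH` FOR THE STABLE ORBITAL FAMILY** of a compactly supported test
function, unconditionally: `2π`-periodicity in the angle slots, the Weyl relations (flip and realised reflection), and vanishing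
for a large split coordinate. [cite: Bouaziz1994IntegralesOrbitales, §6.2 p. 591] [cite: Shelstad1979, §4 pp. 22–23] -/
theorem archBz_periodic_weyl_compactSupport_stOrbFamH (fH : ↥(arch (↥(maximalRealSubfield L)) L (IsCMField.complexConj L) 2 (Matrix.of fun i j : Fin 2 => if i.val + j.val + 1 = 2 then (1 : L) else 0)) ×
      ↥(arch (↥(maximalRealSubfield L)) L (IsCMField.complexConj L) 1 (Matrix.of fun i j : Fin 1 => if i.val + j.val + 1 = 1 then (1 : L) else 0)) → ℂ) (hfH : HasCompactSupport fH) :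
    ArchBzPeriodic (stOrbFamH L νH fH) ∧ ArchBzWeyl (stOrbFamH L νH fH) ∧ ArchBzCompactSupport (stOrbFamH L νH fH) :=
  ⟨archBzPeriodic_stOrbFamH L νH fH, archBzWeyl_stOrbFamH_of_isHaarMeasure L νH fH,
    archBzCompactSupport_stOrbFamH L νH fH hfH⟩

/-- **ASSEMBLY OF THE BOUAZIZ-SPACE MEMBERSHIP OF THE STABLE ORBITAL FAMILY** from the two analytic conjuncts: given (I₃)
(`ArchBzSmoothBounded`) and the jump relations (J) (`ArchBzJump jcH`) for `stOrbFamH L νH fH` — the Harish-Chandra estimates, organs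
O-L1 and O-J of the line — the family lies in `ArchBouazizSpaceH jcH`; (P), (W), (I₄) are supplied by this file.
[cite: Bouaziz1994IntegralesOrbitales, §6.2 p. 591, Thm. 6.2] [cite: Shelstad1979, §4 pp. 22–23] -/
theorem archBouazizSpaceH_stOrbFamH_of_smoothBounded_of_jump
    (jcH : Finset {w : InfinitePlace L // IsComplex w} → {w : InfinitePlace L // IsComplex w} → ℂ) (fH : ↥(arch (↥(maximalRealSubfield L)) L (IsCMField.complexConj L) 2 (Matrix.of fun i j : Fin 2 => if i.val + j.val + 1 = 2 then (1 : L) else 0)) ×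
      ↥(arch (↥(maximalRealSubfield L)) L (IsCMField.complexConj L) 1 (Matrix.of fun i j : Fin 1 => if i.val + j.val + 1 = 1 then (1 : L) else 0)) → ℂ)
    (hfH : HasCompactSupport fH) (hI₃ : ArchBzSmoothBounded (stOrbFamH L νH fH))
    (hJ : ArchBzJump jcH (stOrbFamH L νH fH)) :
    ArchBouazizSpaceH jcH (stOrbFamH L νH fH) :=
  ⟨archBzPeriodic_stOrbFamH L νH fH, archBzWeyl_stOrbFamH_of_isHaarMeasure L νH fH, hI₃, hJ,
    archBzCompactSupport_stOrbFamH L νH fH hfH⟩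

end Literature.NumberTheory.Rogawski1990

end
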